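import Literature.Probability.RandomPlanarGeometry.DiamondShearChart
import HarnessLib

/-!
# The elliptic modulus on the axis is comparable to `e^{-πt}`
# (crux `SubseqCardy`, stmt-CriticalPhenomena-5768, line `registered`: kernel facts V, part 1)

Route `CardyAnchoredRigidity` (decl shared with `CardyLocalRigidity`), sub-problem `CardyFormulaZ2`.
The conformal modulus (Cardy cross-ratio) of the rectangle `(0,w) × (0,1)` with the usual corner
marking is exactly `lamR w = λ(iw) = θ₂(iw)⁴/θ₃(iw)⁴` (tree: `rectangle_crossRatio_eq_lamR`). The
lead proves that every sequential crossing kernel `f` of bond-`ℤ²` percolation satisfies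
`e^{-lw} ≤ f (lamR w) ≤ 2 e^{l(1-w)}`; the present two-sided bound

  `c e^{-πt} ≤ lamR t ≤ C e^{-πt}`   (`0 < t`; some constants `0 < c`, `C`)

(`lamR_exp_sandwich`) converts it into the intrinsic boundary power law `f(η) ≍ η^{l/π}`.
Classically `λ(τ) = 16 q̂ - 128 q̂² + ⋯` with `q̂ = e^{πiτ}`, so `λ(it) ~ 16 e^{-πt}`; only the
comparability is recorded here, with loose constants.

Proof. Write `q̂ = q̂(it) = e^{-πt}` and `G = ∑ₖ c2(k) q̂ᵏ`, so that `θ₂(it) = e^{πi(it)/4} G`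
(`theta2_eq_discFun`) and hence `θ₂(it)⁴ = q̂ G⁴`. The tree's `q̂`-calculus gives `G → c2 0 = 2`
and `θ₃(it) → 1` as `t → ∞` (`isBigOqhat_discFun_qhat`, `isBigOqhat_theta3`,
`IsBigOqhat.tendsto`), so beyond some threshold `T ≥ 1` we have `‖G‖ ∈ [3/2, 5/2]` and
`‖θ₃(it)‖ ∈ [1/2, 3/2]`. Since `θ₂(it)`, `θ₃(it)` are positive reals,
`lamR t = ‖θ₂(it)‖⁴/‖θ₃(it)‖⁴ = e^{-πt} ‖G‖⁴/‖θ₃(it)‖⁴`, whence `e^{-πt} ≤ lamR t ≤ 625 e^{-πt}`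
for `t ≥ T` (`Modulus.lamR_sandwich_of_near`, `Modulus.lamR_exists_threshold`). On `0 < t < T`
use `0 < lamR < 1` (`lamR_mem_Ioo`) and that `lamR` is decreasing (`strictAntiOn_lamR`):
`lamR t ≤ 1 ≤ e^{πT} e^{-πt}` and `lamR t ≥ lamR T ≥ e^{-πT} ≥ e^{-πT} e^{-πt}`. So `c = e^{-πT}`,
`C = 625 e^{πT}` serve all `t > 0`.

References: E. T. Whittaker, G. N. Watson, *A Course of Modern Analysis*, 4th ed. (1927), §21.7
(`λ = 16q - ⋯`); P. Kleban, D. Zagier, *Crossing probabilities and modular forms*, J. Stat.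
Phys. 113 (2003), 431–454, §3 [KlebanZagier2003]; B. Bollobás, O. Riordan, *Percolation*
(2006), p. 185; D. F. Lawden, *Elliptic Functions and Applications* (1989), §1.6.
-/

noncomputable section

namespace Summit.CriticalPhenomena.CardyFormulaZ2.Cruxes.SubseqCardy.Birth

open Set Filter Topology Complex
open scoped Real
open Literature.Probability.RandomPlanarGeometry.KlebanZagier
open Literature.Probability.RandomPlanarGeometry (strictAntiOn_lamR)
open Literature.NumberTheory.EllipticCurves.JacobiThetaNull (theta2 theta3 theta2_I_mul_eq_re
  theta3_I_mul_eq_re theta2_I_mul_re_pos theta3_I_mul_re_pos)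

namespace Modulus

/-- **`θ₂(it)⁴ = q̂(it) · G⁴`** with `G = ∑ₖ c2(k) q̂(it)ᵏ` the `q̂`-series of `θ(τ/2, τ)`
(from `θ₂ = e^{πiτ/4} G`, `theta2_eq_discFun`). [folklore] -/
theorem lamR_theta2_pow_four {t : ℝ} (ht : 0 < t) :
    theta2 (I * t) ^ 4 = qhat (I * t) * discFun c2 (qhat (I * t)) ^ 4 := by
  have him : 0 < im (I * t : ℂ) := by simpa using ht
  rw [theta2_eq_discFun him, mul_pow, ← Complex.exp_nat_mul, qhat]
  congr 2
  push_cast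
  ring

/-- `‖θ₂(it)‖⁴ = e^{-πt} ‖G‖⁴` (`q̂(it) = e^{-πt}` is a positive real). [folklore] -/
theorem lamR_norm_theta2_pow_four {t : ℝ} (ht : 0 < t) :
    ‖theta2 (I * t)‖ ^ 4 = Real.exp (-(π * t)) * ‖discFun c2 (qhat (I * t))‖ ^ 4 := by
  rw [← norm_pow, lamR_theta2_pow_four ht, norm_mul, norm_pow, qhat_I_mul,
    Complex.norm_of_nonneg (Real.exp_pos _).le]

/-- On the axis `lamR t = ‖θ₂(it)‖⁴ / ‖θ₃(it)‖⁴` (`θ₂(it)`, `θ₃(it)` are positive reals).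
[folklore] -/
theorem lamR_eq_norm_div {t : ℝ} (ht : 0 < t) :
    lamR t = ‖theta2 (I * t)‖ ^ 4 / ‖theta3 (I * t)‖ ^ 4 := by
  have h2 : ‖theta2 (I * t)‖ = (theta2 (I * t)).re := by
    conv_lhs => rw [theta2_I_mul_eq_re ht]
    exact Complex.norm_of_nonneg (theta2_I_mul_re_pos ht).le
  have h3 : ‖theta3 (I * t)‖ = (theta3 (I * t)).re := by
    conv_lhs => rw [theta3_I_mul_eq_re ht]
    exact Complex.norm_of_nonneg (theta3_I_mul_re_pos ht).le
  rw [lamR, h2, h3]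

/-- **The sandwich high on the axis.** If `‖G - 2‖ < 1/2` and `‖θ₃(it) - 1‖ < 1/2` (`t > 0`), then
`e^{-πt} ≤ lamR t ≤ 625 e^{-πt}`: indeed `lamR t = e^{-πt} ‖G‖⁴/‖θ₃(it)‖⁴` with
`3/2 ≤ ‖G‖ ≤ 5/2` and `1/2 ≤ ‖θ₃(it)‖ ≤ 3/2`. [folklore] -/
theorem lamR_sandwich_of_near {t : ℝ} (ht : 0 < t)
    (hG : ‖discFun c2 (qhat (I * t)) - 2‖ < 1 / 2) (h3 : ‖theta3 (I * t) - 1‖ < 1 / 2) :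
    Real.exp (-(π * t)) ≤ lamR t ∧ lamR t ≤ 625 * Real.exp (-(π * t)) := by
  have hlam : lamR t =
      Real.exp (-(π * t)) * (‖discFun c2 (qhat (I * t))‖ ^ 4 / ‖theta3 (I * t)‖ ^ 4) := by
    rw [lamR_eq_norm_div ht, lamR_norm_theta2_pow_four ht, mul_div_assoc]
  generalize discFun c2 (qhat (I * t)) = G at hG hlam
  generalize theta3 (I * t) = θ at h3 hlam
  have hGb : |‖G‖ - 2| < 1 / 2 := by
    have h := abs_norm_sub_norm_le G 2
    rw [Complex.norm_two] at h
    exact h.trans_lt hG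
  have hθb : |‖θ‖ - 1| < 1 / 2 := by
    have h := abs_norm_sub_norm_le θ 1
    rw [norm_one] at h
    exact h.trans_lt h3
  obtain ⟨hG1, hG2⟩ := abs_sub_lt_iff.1 hGb
  obtain ⟨hθ1, hθ2⟩ := abs_sub_lt_iff.1 hθb
  have hθpos : 0 < ‖θ‖ := by linarith
  have hθ4 : 0 < ‖θ‖ ^ 4 := pow_pos hθpos 4
  have het : 0 < Real.exp (-(π * t)) := Real.exp_pos _
  rw [hlam]
  constructor
  · refine le_mul_of_one_le_right het.le ?_
    rw [one_le_div hθ4]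
    exact pow_le_pow_left₀ (norm_nonneg _) (by linarith) 4
  · rw [mul_comm]
    refine mul_le_mul_of_nonneg_right ?_ het.le
    rw [div_le_iff₀ hθ4]
    calc ‖G‖ ^ 4 ≤ (5 * ‖θ‖) ^ 4 := pow_le_pow_left₀ (norm_nonneg _) (by linarith) 4
      _ = 625 * ‖θ‖ ^ 4 := by ring

/-- The axis `t ↦ it` tends to `i∞` (the filter `comap im atTop`) as `t → ∞`. [folklore] -/
theorem modulus_tendsto_axis : Tendsto (fun t : ℝ => (I * t : ℂ)) atTop (comap im atTop) := by
  refine tendsto_comap_iff.mpr ?_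
  have : (im ∘ fun t : ℝ => (I * t : ℂ)) = id := by funext t; simp
  rw [this]
  exact tendsto_id

/-- `G(q̂(it)) = ∑ₖ c2(k) e^{-πkt} → c2 0 = 2` as `t → ∞`. [folklore] -/
theorem lamR_tendsto_discFun :
    Tendsto (fun t : ℝ => discFun c2 (qhat (I * t))) atTop (𝓝 2) := by
  have h := (isBigOqhat_discFun_qhat norm_c2_le (by norm_num : (0 : ℝ) ≤ 2)).tendsto
  rw [c2_zero] at h
  exact h.comp modulus_tendsto_axis

/-- `θ₃(it) → 1` as `t → ∞`. [folklore] -/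
theorem lamR_tendsto_theta3 : Tendsto (fun t : ℝ => theta3 (I * t)) atTop (𝓝 1) :=
  isBigOqhat_theta3.tendsto.comp modulus_tendsto_axis

/-- **A threshold for the sandwich**: some `T > 0` with `e^{-πt} ≤ lamR t ≤ 625 e^{-πt}` for all
`t ≥ T`. [folklore] -/
theorem lamR_exists_threshold : ∃ T : ℝ, 0 < T ∧ ∀ t : ℝ, T ≤ t →
    Real.exp (-(π * t)) ≤ lamR t ∧ lamR t ≤ 625 * Real.exp (-(π * t)) := by
  have eG := Metric.tendsto_nhds.1 lamR_tendsto_discFun (1 / 2) (by norm_num)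
  have e3 := Metric.tendsto_nhds.1 lamR_tendsto_theta3 (1 / 2) (by norm_num)
  obtain ⟨T, hT⟩ := Filter.eventually_atTop.1 ((eG.and e3).and (eventually_ge_atTop 1))
  refine ⟨max T 1, lt_max_of_lt_right one_pos, fun t ht => ?_⟩
  obtain ⟨⟨h1, h2⟩, h3⟩ := hT t ((le_max_left _ _).trans ht)
  rw [dist_eq_norm] at h1 h2
  exact lamR_sandwich_of_near (by linarith) h1 h2

end Modulus

/-- **Registered sub-goal `lamR_exp_sandwich` (line `registered`, lead c6; kernel facts V,
part 1) — the elliptic modulus on the axis is comparable to `e^{-πt}`**: there are constants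
`0 < c` and `C` with `c e^{-πt} ≤ λ(it) ≤ C e^{-πt}` for every `t > 0`, where
`λ(it) = lamR t = θ₂(it)⁴/θ₃(it)⁴` is the conformal modulus (Cardy cross-ratio) of the rectangle
`(0,t) × (0,1)`. (Classically `λ(it) = 16 e^{-πt} - 128 e^{-2πt} + ⋯`.)
[cite: KlebanZagier2003, §3] -/
theorem lamR_exp_sandwich : ∃ c C : ℝ, 0 < c ∧ ∀ t : ℝ, 0 < t → c * Real.exp (-(Real.pi * t)) ≤ Literature.Probability.RandomPlanarGeometry.KlebanZagier.lamR t ∧ Literature.Probability.RandomPlanarGeometry.KlebanZagier.lamR t ≤ C * Real.exp (-(Real.pi * t)) := by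
  obtain ⟨T, hT0, hT⟩ := Modulus.lamR_exists_threshold
  refine ⟨Real.exp (-(π * T)), 625 * Real.exp (π * T), Real.exp_pos _, fun t ht => ?_⟩
  have hπT : 0 < π * T := mul_pos Real.pi_pos hT0
  have hπt : 0 < π * t := mul_pos Real.pi_pos ht
  have hc1 : Real.exp (-(π * T)) ≤ 1 := Real.exp_le_one_iff.2 (by linarith)
  have hC1 : 1 ≤ Real.exp (π * T) := Real.one_le_exp hπT.le
  have het : 0 < Real.exp (-(π * t)) := Real.exp_pos _
  have het1 : Real.exp (-(π * t)) ≤ 1 := Real.exp_le_one_iff.2 (by linarith)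
  rcases le_or_gt T t with hTt | htT
  · obtain ⟨h1, h2⟩ := hT t hTt
    constructor
    · calc Real.exp (-(π * T)) * Real.exp (-(π * t)) ≤ 1 * Real.exp (-(π * t)) :=
            mul_le_mul_of_nonneg_right hc1 het.le
        _ = Real.exp (-(π * t)) := one_mul _
        _ ≤ lamR t := h1
    · calc lamR t ≤ 625 * Real.exp (-(π * t)) := h2
        _ ≤ 625 * Real.exp (π * T) * Real.exp (-(π * t)) :=
            mul_le_mul_of_nonneg_right (by linarith) het.le
  · have hl := lamR_mem_Ioo ht
    constructor
    · have hmono : lamR T ≤ lamR t :=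
        strictAntiOn_lamR.antitoneOn (mem_Ioi.2 ht) (mem_Ioi.2 hT0) htT.le
      calc Real.exp (-(π * T)) * Real.exp (-(π * t)) ≤ Real.exp (-(π * T)) :=
            mul_le_of_le_one_right (Real.exp_pos _).le het1
        _ ≤ lamR T := (hT T le_rfl).1
        _ ≤ lamR t := hmono
    · have h1 : 1 ≤ Real.exp (π * T) * Real.exp (-(π * t)) := by
        rw [← Real.exp_add]
        exact Real.one_le_exp (by nlinarith [Real.pi_pos])
      calc lamR t ≤ 1 := hl.2.le
        _ ≤ Real.exp (π * T) * Real.exp (-(π * t)) := h1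
        _ ≤ 625 * (Real.exp (π * T) * Real.exp (-(π * t))) :=
            le_mul_of_one_le_left (by positivity) (by norm_num)
        _ = 625 * Real.exp (π * T) * Real.exp (-(π * t)) := (mul_assoc _ _ _).symm

end Summit.CriticalPhenomena.CardyFormulaZ2.Cruxes.SubseqCardy.Birth

end
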